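import Summits.ResolutionOfSingularities.ResolutionOfSingularities.Theorems.FrobeniusLadderFInjectiveMacaulayficationG1TailData
import Summits.ResolutionOfSingularities.ResolutionOfSingularities.Theorems.FrobeniusLadderFInjectiveMacaulayficationG1CornerVeroneseSplitting
import Summits.ResolutionOfSingularities.ResolutionOfSingularities.Theorems.FrobeniusLadderFInjectiveMacaulayficationHFedderCertificates
import Summits.ResolutionOfSingularities.ResolutionOfSingularities.Theorems.FrobeniusLadderFInjectiveMacaulayficationDoublePointFedderOdd
import Summits.ResolutionOfSingularities.ResolutionOfSingularities.Theorems.FrobeniusLadderFInjectiveMacaulayficationBP237Charts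
import Summits.ResolutionOfSingularities.ResolutionOfSingularities.Theorems.FrobeniusLadderFInjectiveMacaulayficationWeightedConeCore
import Mathlib.Algebra.MvPolynomial.Equiv
import Mathlib.Algebra.MvPolynomial.PDeriv
import Mathlib.Algebra.CharP.Lemmas
import Mathlib.Data.Nat.Choose.Sum
import Mathlib.Logic.Equiv.Fin.Basic
import HarnessLib
import Summits.ResolutionOfSingularities.ResolutionOfSingularities.Theorems.FrobeniusLadderFInjectiveMacaulayficationFilteredConeFiModel

/-!
# `f = z² + x³y² + y³ + xy⁴` at every ODD prime: the off-origin clause, and ONE weighted blow-up modulo the filtered engine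
# (crux `FInjectiveMacaulayfication`, line `graded-engine` §17 filtered engine G4♮/G5♮, calibration G6f)

Support file for crux stmt-ResolutionOfSingularities-15315 (`FrobeniusLadder.FInjectiveMacaulayfication`), chain w45a,
seat res-L1-w45a-stub-3. [OURS · L1 W4.5a, CRUX-PLAN v4 §4; tri-1 TRIAGE §12 specimen] — NOT a statement of the manuscript;
AI-written, weaker than expert review.

tri-1's G1-OUTSIDE-GRADED specimen `f = X₂² + X₀³X₁² + X₁³ + X₀X₁⁴` is semi-quasi-homogeneous for `w = (2,6,9)` with initial
form the corner `g = X₂² + X₀³X₁² + X₁³` (stub-1's `G1CornerGradedData`, whose `g1Corner_offOrigin_clause` is the cone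
hypothesis `hoff₀`). This file supplies `hoff` for `f` itself at every odd `p` and states the model modulo G5♮:

* `coeff_doubleLine_pow` — the GENERIC `A₁ × line` Fedder coefficient, in `B[Y₀,Y₁]` over any commutative ring:
  `coeff_{Y₀^{2h}Y₁^{2h}} (Y₁² + Y₀²·u)^{2h} = C(2h,h)·u(0)^h` (binomial theorem; only the middle term has both exponents
  `≤ 2h`) — reusable for every hypersurface of the shape `z² + y²·(unit along the line)`;
* `clause_doubleLine_oddChar` — along `L ∖ 0` (`P ⊋ (X₁, X₂)`, `X₀ ∉ P`): slicing `k[X] ≃ B[Y₀,Y₁]`, `B = k[X₀]`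
  (`exists_baseSlicing0`), `Ψ f = Y₁² + Y₀²(x³ + Y₀ + xY₀²)`, so the extracted coefficient of `f^{p-1}` is
  `C(p-1,(p-1)/2)·x^{3(p-1)/2}`, a unit times a power of `x`; `f^{p-1} ∈ P^[p]` would put it in `𝔭 ⊆ k[X₀]`, i.e. `X₀ ∈ P` —
  excluded (`CoordinateSlicing.coeff_mem_span_of_mem_span`, `FedderAtMaximalIdeal.stub_fedderAtMaximalIdeal`);
* `g1Tail_offOrigin_clause` — `hoff` at every odd `p`: `X₂ ∉ P` ⇒ `∂₂f = 2X₂ ∉ P`; `X₂ ∈ P ∌ X₁` ⇒ `v = X₀³ + X₁ + X₀X₁² ∈ P` and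
  NOT both `∂₀f = X₁²w₀`, `∂₁f = X₁w₁` lie in `P` (the Jacobian identities of `G1TailData` give `4X₀³ ∈ P`, then
  `X₁² = w₀ − 3X₀² ∈ P`); `X₁, X₂ ∈ P` ⇒ the line certificate;
* `g1TailFilteredFiModel_of_filteredEngine` — the statement of G5♮ `FilteredEngine.filteredConeFiModel_of_filteredChartClause`
  (verbatim from `L/w45a/FilteredEngineSig.lean`, as a hypothesis) implies: for every ODD prime `p` and field `k` of
  characteristic `p`, `Spec k[X]/(f)` has a proper birational model with Cohen–Macaulay F-injective domain stalks — the
  `(2,6,9)`-weighted blow-up `affineBlowup I₁₈` (`c = (9,3,2)`, `D = 18`).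

All proofs are glue on Mathlib and landed files; no definitions, no named facts. References: [Fedder1983] R. Fedder, *F-purity
and rational singularity*, Trans. AMS 278 (1983), Prop. 1.7, Thm. 1.12 (through the imported criterion). [folklore]
-/

-- single-problem summit: the doubled namespace component is forced
set_option linter.dupNamespace false

noncomputable section

open CategoryTheory AlgebraicGeometry

namespace Summit.ResolutionOfSingularities.ResolutionOfSingularities.Theorems.FInjectiveMacaulayfication.G1TailFilteredFiModel

open MvPolynomial IsLocalRing
open Summit.ResolutionOfSingularities.ResolutionOfSingularities.Theorems.FInjectiveMacaulayfication

/-! ## The generic `A₁ × line` Fedder coefficient -/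

/-- **The `A₁ × line` coefficient.** In `B[Y₀,Y₁]` over any commutative ring, for any `u`:
`coeff_{Y₀^{2h} Y₁^{2h}} (Y₁² + Y₀²u)^{2h} = C(2h,h) · u(0)^h` — in the binomial expansion the term
`C(2h,m) Y₁^{2m} (Y₀²u)^{2h-m}` has `Y₁`-exponent `2m > 2h` if `m > h` and `Y₀`-exponent `≥ 2(2h-m) > 2h` if `m < h`; the middle
term contributes `C(2h,h)` times the constant coefficient of `u^h`. [folklore] -/
theorem coeff_doubleLine_pow {B : Type*} [CommRing B] (u : MvPolynomial (Fin 2) B) (h : ℕ) :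
    coeff (Finsupp.single (0 : Fin 2) (2 * h) + Finsupp.single 1 (2 * h)) ((X 1 ^ 2 + X 0 ^ 2 * u) ^ (2 * h)) =
      ((2 * h).choose h : B) * constantCoeff u ^ h := by
  have hd0 : (Finsupp.single (0 : Fin 2) (2 * h) + Finsupp.single 1 (2 * h) : Fin 2 →₀ ℕ) 0 = 2 * h := by simp
  have hd1 : (Finsupp.single (0 : Fin 2) (2 * h) + Finsupp.single 1 (2 * h) : Fin 2 →₀ ℕ) 1 = 2 * h := by simp
  rw [add_pow, coeff_sum, Finset.sum_eq_single h]
  · -- the middle term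
    have e : ((X 1 ^ 2) ^ h * (X 0 ^ 2 * u) ^ (2 * h - h) * ((2 * h).choose h : MvPolynomial (Fin 2) B)) =
        C ((2 * h).choose h : B) * (monomial (Finsupp.single (0 : Fin 2) (2 * h) + Finsupp.single 1 (2 * h)) 1 * u ^ h) := by
      have hM : (monomial (Finsupp.single (0 : Fin 2) (2 * h) + Finsupp.single 1 (2 * h)) 1 : MvPolynomial (Fin 2) B) =
          X 0 ^ (2 * h) * X 1 ^ (2 * h) := by
        rw [X_pow_eq_monomial, X_pow_eq_monomial, monomial_mul, one_mul]
      rw [show 2 * h - h = h by omega, map_natCast, hM]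
      ring
    rw [e, coeff_C_mul, coeff_monomial_mul', if_pos le_rfl, tsub_self, one_mul, ← constantCoeff_eq, map_pow]
  · -- the other terms vanish
    intro b _ hb
    rcases Nat.lt_or_gt_of_ne hb with hlt | hgt
    · -- `b < h`: `Y₀`-exponent `2(2h - b) > 2h`
      have e : ((X 1 ^ 2) ^ b * (X 0 ^ 2 * u) ^ (2 * h - b) * ((2 * h).choose b : MvPolynomial (Fin 2) B)) =
          X 0 ^ (2 * (2 * h - b)) * ((X 1 ^ 2) ^ b * u ^ (2 * h - b) * ((2 * h).choose b : MvPolynomial (Fin 2) B)) := by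
        rw [mul_pow, ← pow_mul]
        ring
      rw [e]
      exact HFedderCertificates.coeff_X_pow_mul_eq_zero _ 0 _ (by rw [hd0]; omega) _
    · -- `h < b`: `Y₁`-exponent `2b > 2h`
      have e : ((X 1 ^ 2) ^ b * (X 0 ^ 2 * u) ^ (2 * h - b) * ((2 * h).choose b : MvPolynomial (Fin 2) B)) =
          X 1 ^ (2 * b) * ((X 0 ^ 2 * u) ^ (2 * h - b) * ((2 * h).choose b : MvPolynomial (Fin 2) B)) := by
        rw [← pow_mul]
        ring
      rw [e]
      exact HFedderCertificates.coeff_X_pow_mul_eq_zero _ 1 _ (by rw [hd1]; omega) _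
  · intro hn
    exact absurd (Finset.mem_range.mpr (by omega)) hn

/-! ## The slicing with base `k[X₀]` and slices `X₁, X₂` -/

/-- **Slicing** `k[X₀,X₁,X₂] ≃ B[Y₀,Y₁]`, `B = k[X₀]` (as `MvPolynomial (Fin 1) k`): `X₀ ↦ C X₀`, `X₁ ↦ Y₀`, `X₂ ↦ Y₁`
(`renameEquiv` along `(finRotate 3)⁻¹` then `finSumFinEquiv.symm : Fin 3 ≃ Fin 2 ⊕ Fin 1`, followed by `sumAlgEquiv`). [folklore] -/
theorem exists_baseSlicing0 (k : Type) [Field k] :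
    ∃ Ψ : MvPolynomial (Fin 3) k ≃+* MvPolynomial (Fin 2) (MvPolynomial (Fin 1) k),
      Ψ (X 0) = C (X 0) ∧ Ψ (X 1) = X 0 ∧ Ψ (X 2) = X 1 := by
  have e0 : ((finRotate 3).symm.trans (@finSumFinEquiv 2 1).symm) 0 = Sum.inr 0 := by decide
  have e1 : ((finRotate 3).symm.trans (@finSumFinEquiv 2 1).symm) 1 = Sum.inl 0 := by decide
  have e2 : ((finRotate 3).symm.trans (@finSumFinEquiv 2 1).symm) 2 = Sum.inl 1 := by decide
  refine ⟨((renameEquiv k ((finRotate 3).symm.trans (@finSumFinEquiv 2 1).symm)).trans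
    (sumAlgEquiv k (Fin 2) (Fin 1))).toRingEquiv, ?_, ?_, ?_⟩
  · show sumAlgEquiv k (Fin 2) (Fin 1) (rename _ (X 0)) = _
    rw [rename_X, e0]
    exact sumAlgEquiv_X_inr _ _ _ _
  · show sumAlgEquiv k (Fin 2) (Fin 1) (rename _ (X 1)) = _
    rw [rename_X, e1]
    exact sumAlgEquiv_X_inl _ _ _ _
  · show sumAlgEquiv k (Fin 2) (Fin 1) (rename _ (X 2)) = _
    rw [rename_X, e2]
    exact sumAlgEquiv_X_inl _ _ _ _

/-! ## The Fedder certificate along the line `L ∖ 0` -/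

/-- **FEDDER CERTIFICATE ALONG `L = {X₁ = X₂ = 0}` OFF THE ORIGIN (every odd `p`)**: at every maximal ideal `Q` of
`k[X]/(f)` containing `x̄₁, x̄₂` but not `x̄₀`, the local ring satisfies the Cohen–Macaulay + Frobenius-closed clause
(transversal type `A₁ × line`: `Ψ f = Y₁² + Y₀²(x³ + Y₀ + xY₀²)`, `coeff_doubleLine_pow`). [cite: Fedder1983, Thm. 1.12] -/
theorem clause_doubleLine_oddChar (p : ℕ) [hp : Fact p.Prime] (hp2 : p ≠ 2) (k : Type) [Field k] [CharP k p]
    (f : MvPolynomial (Fin 3) k) (hf : f = X 2 ^ 2 + X 0 ^ 3 * X 1 ^ 2 + X 1 ^ 3 + X 0 * X 1 ^ 4)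
    (Q : Ideal (MvPolynomial (Fin 3) k ⧸ Ideal.span {f})) [Q.IsMaximal]
    (hQ1 : Ideal.Quotient.mk (Ideal.span {f}) (X 1) ∈ Q) (hQ2 : Ideal.Quotient.mk (Ideal.span {f}) (X 2) ∈ Q)
    (hQ0 : Ideal.Quotient.mk (Ideal.span {f}) (X 0) ∉ Q) :
    ∀ d : ℕ, ringKrullDim (Localization.AtPrime Q) = d → ∀ s : Fin d → Localization.AtPrime Q,
      (Ideal.span (Set.range s)).radical.IsMaximal →
        RingTheory.Sequence.IsWeaklyRegular (Localization.AtPrime Q) (List.ofFn s) ∧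
        ∀ y : Localization.AtPrime Q, (∃ e : ℕ, y ^ p ^ e ∈ Ideal.span
          ((fun z : Localization.AtPrime Q => z ^ p ^ e) ''
            (Ideal.span (Set.range s) : Set (Localization.AtPrime Q)))) → y ∈ Ideal.span (Set.range s) := by
  obtain ⟨m, hm⟩ : ∃ m : ℕ, p = 2 * m + 1 := by
    rcases hp.out.eq_two_or_odd with h2 | hodd
    exacts [absurd h2 hp2, ⟨p / 2, by omega⟩]
  haveI hPmax : (Q.comap (Ideal.Quotient.mk (Ideal.span {f}))).IsMaximal :=
    Ideal.comap_isMaximal_of_surjective _ Ideal.Quotient.mk_surjective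
  obtain ⟨Ψ, hΨ0, hΨ1, hΨ2⟩ := exists_baseSlicing0 k
  have hy0 : Ψ.symm (X 0) = X 1 := Ψ.symm_apply_eq.mpr hΨ1.symm
  have hy1 : Ψ.symm (X 1) = X 2 := Ψ.symm_apply_eq.mpr hΨ2.symm
  have hb0 : Ψ.symm (C (X 0)) = X 0 := Ψ.symm_apply_eq.mpr hΨ0.symm
  have hy : ∀ s : Fin 2, Ψ.symm (X s) ∈ Q.comap (Ideal.Quotient.mk (Ideal.span {f})) := by
    intro s
    fin_cases s
    · exact hy0 ▸ Ideal.mem_comap.mpr hQ1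
    · exact hy1 ▸ Ideal.mem_comap.mpr hQ2
  haveI h𝔭 : ((Q.comap (Ideal.Quotient.mk (Ideal.span {f}))).comap (Ψ.symm.toRingHom.comp C)).IsMaximal :=
    CoordinateSlicing.comap_slice_isMaximal Ψ _ hy
  obtain ⟨n, a, ha⟩ := Submodule.fg_iff_exists_fin_generating_family.mp
    (IsNoetherian.noetherian ((Q.comap (Ideal.Quotient.mk (Ideal.span {f}))).comap (Ψ.symm.toRingHom.comp C)))
  have hPA := CoordinateSlicing.eq_span_sliceFamily Ψ _ hy a ha
  have hf0 : f ≠ 0 := (G1TailData.prime_g1Tail k f hf).1.ne_zero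
  refine FedderAtMaximalIdeal.stub_fedderAtMaximalIdeal p k 3 (2 + n) _ f Q hPA hf0 ?_
  intro hmem
  have hd : ∀ s : Fin 2, (Finsupp.single (0 : Fin 2) (2 * m) + Finsupp.single 1 (2 * m) : Fin 2 →₀ ℕ) s < p := by
    intro s
    fin_cases s <;> simp <;> omega
  have hext := CoordinateSlicing.coeff_mem_span_of_mem_span Ψ
    (Finsupp.single (0 : Fin 2) (2 * m) + Finsupp.single 1 (2 * m)) p hd a hmem
  -- the extracted coefficient is `C(2m,m) · x^{3m}`
  have hΨf : Ψ f = X 1 ^ 2 + X 0 ^ 2 * (C (X 0) ^ 3 + X 0 + C (X 0) * X 0 ^ 2) := by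
    rw [hf]
    simp only [map_add, map_mul, map_pow, hΨ0, hΨ1, hΨ2]
    ring
  have hval : coeff (Finsupp.single (0 : Fin 2) (2 * m) + Finsupp.single 1 (2 * m)) (Ψ (f ^ (p - 1))) =
      ((2 * m).choose m : MvPolynomial (Fin 1) k) * (X 0 ^ 3) ^ m := by
    rw [map_pow, hΨf, show p - 1 = 2 * m by omega, coeff_doubleLine_pow]
    congr 1
    simp only [map_add, map_pow, map_mul, constantCoeff_C, constantCoeff_X]
    ring
  rw [hval] at hext
  -- so `x^{3m} ∈ 𝔞 ⊆ 𝔭`, i.e. `X₀ ∈ P`: excluded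
  have hu : IsUnit ((2 * m).choose m : MvPolynomial (Fin 1) k) := by
    have hk : (((2 * m).choose m : ℕ) : k) ≠ 0 :=
      DoublePointFedder.cast_choose_ne_zero p (Nat.le_mul_of_pos_left m (by norm_num)) (by omega)
    have hC := (isUnit_iff_ne_zero.mpr hk).map (C : k →+* MvPolynomial (Fin 1) k)
    rwa [map_natCast] at hC
  have hpow : ((X 0 ^ 3) ^ m : MvPolynomial (Fin 1) k) ∈ Ideal.span (Set.range fun j => a j ^ p) :=
    (Ideal.unit_mul_mem_iff_mem _ hu).mp hext
  have h𝔞 : Ideal.span (Set.range fun j => a j ^ p) ≤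
      (Q.comap (Ideal.Quotient.mk (Ideal.span {f}))).comap (Ψ.symm.toRingHom.comp C) := by
    rw [Ideal.span_le]
    rintro _ ⟨j, rfl⟩
    refine Ideal.pow_mem_of_mem _ ?_ p hp.out.pos
    rw [← ha]
    exact Ideal.subset_span (Set.mem_range_self j)
  have hX0 : (X 0 : MvPolynomial (Fin 1) k) ∈
      (Q.comap (Ideal.Quotient.mk (Ideal.span {f}))).comap (Ψ.symm.toRingHom.comp C) :=
    h𝔭.isPrime.mem_of_pow_mem 3 (h𝔭.isPrime.mem_of_pow_mem m (h𝔞 hpow))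
  have hX0' : (X 0 : MvPolynomial (Fin 3) k) ∈ Q.comap (Ideal.Quotient.mk (Ideal.span {f})) := by
    have := Ideal.mem_comap.mp hX0
    rwa [RingHom.comp_apply, RingEquiv.toRingHom_eq_coe, RingEquiv.coe_toRingHom, hb0] at this
  exact hQ0 (Ideal.mem_comap.mp hX0')

/-! ## The off-origin clause at every odd prime -/

/-- **THE OFF-ORIGIN CLAUSE FOR `f = z² + x³y² + y³ + xy⁴` AT EVERY ODD PRIME** (input `hoff` of the filtered engine): at
every maximal ideal `Q` of `k[X₀,X₁,X₂]/(f)` missing some `x̄ⱼ`, the local ring satisfies the Cohen–Macaulay + Frobenius-closed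
clause — Jacobian off the line `L = {X₁ = X₂ = 0}`, Fedder along `L ∖ 0`. [cite: Fedder1983, Thm. 1.12] -/
theorem g1Tail_offOrigin_clause (p : ℕ) [hp : Fact p.Prime] (hp2 : p ≠ 2) (k : Type) [Field k] [CharP k p]
    (f : MvPolynomial (Fin 3) k)
    (hf : f = MvPolynomial.X 2 ^ 2 + MvPolynomial.X 0 ^ 3 * MvPolynomial.X 1 ^ 2 + MvPolynomial.X 1 ^ 3 +
      MvPolynomial.X 0 * MvPolynomial.X 1 ^ 4) :
    ∀ (Q : Ideal (MvPolynomial (Fin 3) k ⧸ Ideal.span {f})) [Q.IsMaximal],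
      (∃ j : Fin 3, Ideal.Quotient.mk (Ideal.span {f}) (MvPolynomial.X j) ∉ Q) →
      ∀ d : ℕ, ringKrullDim (Localization.AtPrime Q) = d → ∀ s : Fin d → Localization.AtPrime Q,
        (Ideal.span (Set.range s)).radical.IsMaximal →
          RingTheory.Sequence.IsWeaklyRegular (Localization.AtPrime Q) (List.ofFn s) ∧
          ∀ y : Localization.AtPrime Q, (∃ e : ℕ, y ^ p ^ e ∈ Ideal.span
            ((fun z : Localization.AtPrime Q => z ^ p ^ e) ''
              (Ideal.span (Set.range s) : Set (Localization.AtPrime Q)))) → y ∈ Ideal.span (Set.range s) := by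
  intro Q _ hj d hd s hs
  haveI hPmax : (Q.comap (Ideal.Quotient.mk (Ideal.span {f}))).IsMaximal :=
    Ideal.comap_isMaximal_of_surjective _ Ideal.Quotient.mk_surjective
  have hP := hPmax.isPrime
  have hfP : f ∈ Q.comap (Ideal.Quotient.mk (Ideal.span {f})) := by
    rw [Ideal.mem_comap, Ideal.Quotient.eq_zero_iff_mem.mpr (Ideal.mem_span_singleton_self f)]
    exact Q.zero_mem
  have hu2 : IsUnit (2 : MvPolynomial (Fin 3) k) := by
    simpa using BP237Charts.isUnit_natCast_of_ne p k 2 Nat.prime_two hp2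
  have hu4 : IsUnit (4 : MvPolynomial (Fin 3) k) := by
    have e : (4 : MvPolynomial (Fin 3) k) = 2 * 2 := by norm_num
    rw [e]
    exact hu2.mul hu2
  have hd0 : pderiv 0 f = X 1 ^ 2 * (3 * X 0 ^ 2 + X 1 ^ 2) := by rw [hf, G1TailData.pderiv_zero_g1Tail]
  have hd1 : pderiv 1 f = X 1 * (2 * X 0 ^ 3 + 3 * X 1 + 4 * X 0 * X 1 ^ 2) := by rw [hf, G1TailData.pderiv_one_g1Tail]
  have hd2 : pderiv 2 f = 2 * X 2 := by rw [hf, G1TailData.pderiv_two_g1Tail]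
  by_cases hX2 : (X 2 : MvPolynomial (Fin 3) k) ∈ Q.comap (Ideal.Quotient.mk (Ideal.span {f})); swap
  · -- `X₂ ∉ P`: `∂₂f = 2X₂ ∉ P`
    refine ClauseOfPderivNotMem.stub_clauseOfPderivNotMem p k 3 f Q 2 ?_ d hd s hs
    rw [hd2]
    exact fun h => hX2 ((Ideal.unit_mul_mem_iff_mem _ hu2).mp h)
  by_cases hX1 : (X 1 : MvPolynomial (Fin 3) k) ∈ Q.comap (Ideal.Quotient.mk (Ideal.span {f}))
  · -- the line `X₁, X₂ ∈ P`: then `X₀ ∉ P`, Fedder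
    have hQ0 : Ideal.Quotient.mk (Ideal.span {f}) (X 0) ∉ Q := by
      obtain ⟨j, hj⟩ := hj
      fin_cases j
      · exact hj
      · exact absurd (Ideal.mem_comap.mp hX1) hj
      · exact absurd (Ideal.mem_comap.mp hX2) hj
    exact clause_doubleLine_oddChar p hp2 k f hf Q (Ideal.mem_comap.mp hX1) (Ideal.mem_comap.mp hX2) hQ0 d hd s hs
  · -- `X₂ ∈ P`, `X₁ ∉ P`: a regular point
    have hv : (X 0 ^ 3 + X 1 + X 0 * X 1 ^ 2 : MvPolynomial (Fin 3) k) ∈ Q.comap (Ideal.Quotient.mk (Ideal.span {f})) := by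
      have e : (X 1 ^ 2 * (X 0 ^ 3 + X 1 + X 0 * X 1 ^ 2) : MvPolynomial (Fin 3) k) = f - X 2 * X 2 := by
        rw [hf]; ring
      have hmem : (X 1 ^ 2 * (X 0 ^ 3 + X 1 + X 0 * X 1 ^ 2) : MvPolynomial (Fin 3) k) ∈
          Q.comap (Ideal.Quotient.mk (Ideal.span {f})) := by
        rw [e]
        exact Ideal.sub_mem _ hfP (Ideal.mul_mem_left _ _ hX2)
      rcases hP.mem_or_mem hmem with h1 | h
      · exact absurd (hP.mem_of_pow_mem 2 h1) hX1
      · exact h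
    by_cases hm0 : pderiv 0 f ∈ Q.comap (Ideal.Quotient.mk (Ideal.span {f})); swap
    · exact ClauseOfPderivNotMem.stub_clauseOfPderivNotMem p k 3 f Q 0 hm0 d hd s hs
    by_cases hm1 : pderiv 1 f ∈ Q.comap (Ideal.Quotient.mk (Ideal.span {f})); swap
    · exact ClauseOfPderivNotMem.stub_clauseOfPderivNotMem p k 3 f Q 1 hm1 d hd s hs
    exfalso
    -- `w₀, w₁ ∈ P`
    have hw0 : (3 * X 0 ^ 2 + X 1 ^ 2 : MvPolynomial (Fin 3) k) ∈ Q.comap (Ideal.Quotient.mk (Ideal.span {f})) := by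
      rw [hd0] at hm0
      rcases hP.mem_or_mem hm0 with h1 | h
      · exact absurd (hP.mem_of_pow_mem 2 h1) hX1
      · exact h
    have hw1 : (2 * X 0 ^ 3 + 3 * X 1 + 4 * X 0 * X 1 ^ 2 : MvPolynomial (Fin 3) k) ∈
        Q.comap (Ideal.Quotient.mk (Ideal.span {f})) := by
      rw [hd1] at hm1
      rcases hP.mem_or_mem hm1 with h1 | h
      · exact absurd h1 hX1
      · exact h
    -- `t = 3 + 2X₀X₁ ∈ P` by the first identity
    have ht : (3 + 2 * X 0 * X 1 : MvPolynomial (Fin 3) k) ∈ Q.comap (Ideal.Quotient.mk (Ideal.span {f})) := by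
      have hmem : (X 1 * (3 + 2 * X 0 * X 1) : MvPolynomial (Fin 3) k) ∈ Q.comap (Ideal.Quotient.mk (Ideal.span {f})) := by
        rw [← G1TailData.jacobian_identity_one]
        exact Ideal.sub_mem _ (Ideal.mul_mem_left _ _ hv) (Ideal.mul_mem_left _ _ hw0)
      rcases hP.mem_or_mem hmem with h1 | h
      · exact absurd h1 hX1
      · exact h
    -- `4X₀³ ∈ P` by the second identity, so `X₀ ∈ P`
    have hX0 : (X 0 : MvPolynomial (Fin 3) k) ∈ Q.comap (Ideal.Quotient.mk (Ideal.span {f})) := by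
      have h4 : (4 * X 0 ^ 3 : MvPolynomial (Fin 3) k) ∈ Q.comap (Ideal.Quotient.mk (Ideal.span {f})) := by
        rw [G1TailData.jacobian_identity_two]
        exact Ideal.sub_mem _ (Ideal.add_mem _ (Ideal.mul_mem_left _ _ ht) (Ideal.mul_mem_left _ _ hw0)) hw1
      exact hP.mem_of_pow_mem 3 ((Ideal.unit_mul_mem_iff_mem _ hu4).mp h4)
    -- hence `X₁² = w₀ − 3X₀² ∈ P`, contradiction
    refine hX1 (hP.mem_of_pow_mem 2 ?_)
    have e : (X 1 ^ 2 : MvPolynomial (Fin 3) k) = (3 * X 0 ^ 2 + X 1 ^ 2) - 3 * X 0 * X 0 := by ring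
    rw [e]
    exact Ideal.sub_mem _ hw0 (Ideal.mul_mem_left _ _ hX0)

/-! ## The model modulo the filtered engine G5♮ -/

/-- **G6f modulo G5♮ — ONE `(2,6,9)`-WEIGHTED BLOW-UP F-INJECTIVIZES `z² + x³y² + y³ + xy⁴` AT EVERY ODD PRIME, GIVEN THE
FILTERED ENGINE**: assuming the statement of plan-1's §17 filtered engine G5♮
`FilteredEngine.filteredConeFiModel_of_filteredChartClause` (hypothesis `hG5f`, verbatim from `L/w45a/FilteredEngineSig.lean`),
for every odd prime `p` and field `k` of characteristic `p`, the surface `Spec k[X₀,X₁,X₂]/(X₂² + X₀³X₁² + X₁³ + X₀X₁⁴)` —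
tri-1's specimen outside the graded class — has a proper birational model (the weighted blow-up of the origin, weights
`(2,6,9)`, `affineBlowup I₁₈`, `c = (9,3,2)`, `D = 18`) all of whose stalks are domains in which every system of parameters is
weakly regular and generates a Frobenius closed ideal. Inputs: stub-1's corner data (`G1CornerVeroneseSplitting`,
`G1CornerGradedData.g1Corner_offOrigin_clause` = `hoff₀`), `G1TailData`, and `g1Tail_offOrigin_clause` = `hoff`. [folklore] -/
theorem g1TailFilteredFiModel_of_filteredEngine
    (hG5f : ∀ (p : ℕ) [Fact p.Prime] (k : Type) [Field k] [CharP k p] (n : ℕ) (w : Fin n → ℕ)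
      (N D : ℕ) (c : Fin n → ℕ), 0 < N → (∀ v : Fin n, 0 < w v ∧ c v * w v = N) →
      (∀ (K : ℕ) (b : Fin n →₀ ℕ), K * N ≤ Finsupp.weight w b → (MvPolynomial.monomial b (1 : k) : MvPolynomial (Fin n) k) ∈
        (Ideal.span {m : MvPolynomial (Fin n) k | ∃ b : Fin n →₀ ℕ, N ≤ Finsupp.weight w b ∧ m = MvPolynomial.monomial b 1}) ^ K) →
      ∀ (f f₀ : MvPolynomial (Fin n) k), f₀ = MvPolynomial.weightedHomogeneousComponent w D f →
      (∀ m < D, MvPolynomial.weightedHomogeneousComponent w m f = 0) → f₀ ≠ 0 → (Ideal.span {f}).IsPrime →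
      (∀ v : Fin n, Ideal.Quotient.mk (Ideal.span {f}) (MvPolynomial.X v) ≠ 0) →
      (∀ (Q : Ideal (MvPolynomial (Fin n) k ⧸ Ideal.span {f})) [Q.IsMaximal],
        (∃ j : Fin n, Ideal.Quotient.mk (Ideal.span {f}) (MvPolynomial.X j) ∉ Q) →
        ∀ d : ℕ, ringKrullDim (Localization.AtPrime Q) = d → ∀ s : Fin d → Localization.AtPrime Q,
          (Ideal.span (Set.range s)).radical.IsMaximal →
            RingTheory.Sequence.IsWeaklyRegular (Localization.AtPrime Q) (List.ofFn s) ∧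
            ∀ y : Localization.AtPrime Q, (∃ e : ℕ, y ^ p ^ e ∈ Ideal.span
              ((fun z : Localization.AtPrime Q => z ^ p ^ e) ''
                (Ideal.span (Set.range s) : Set (Localization.AtPrime Q)))) → y ∈ Ideal.span (Set.range s)) →
      (∀ (Q : Ideal (MvPolynomial (Fin n) k ⧸ Ideal.span {f₀})) [Q.IsMaximal],
        (∃ j : Fin n, Ideal.Quotient.mk (Ideal.span {f₀}) (MvPolynomial.X j) ∉ Q) →
        ∀ d : ℕ, ringKrullDim (Localization.AtPrime Q) = d → ∀ s : Fin d → Localization.AtPrime Q,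
          (Ideal.span (Set.range s)).radical.IsMaximal →
            RingTheory.Sequence.IsWeaklyRegular (Localization.AtPrime Q) (List.ofFn s) ∧
            ∀ y : Localization.AtPrime Q, (∃ e : ℕ, y ^ p ^ e ∈ Ideal.span
              ((fun z : Localization.AtPrime Q => z ^ p ^ e) ''
                (Ideal.span (Set.range s) : Set (Localization.AtPrime Q)))) → y ∈ Ideal.span (Set.range s)) →
      ∃ (X' : Scheme.{0}) (π : X' ⟶ Spec (.of (MvPolynomial (Fin n) k ⧸ Ideal.span {f}))), IsProper π ∧
        Literature.AlgebraicGeometry.Resolution.IsBirational π ∧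
        ∀ y : X', IsDomain (X'.presheaf.stalk y) ∧ ∀ d : ℕ, ringKrullDim (X'.presheaf.stalk y) = d →
          ∀ s : Fin d → X'.presheaf.stalk y, (Ideal.span (Set.range s)).radical.IsMaximal →
            RingTheory.Sequence.IsWeaklyRegular (X'.presheaf.stalk y) (List.ofFn s) ∧
            ∀ z : X'.presheaf.stalk y, (∃ e : ℕ, z ^ p ^ e ∈
                Ideal.span ((fun w : X'.presheaf.stalk y => w ^ p ^ e) ''
                  (Ideal.span (Set.range s) : Set (X'.presheaf.stalk y)))) →
              z ∈ Ideal.span (Set.range s)) :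
    ∀ (p : ℕ) [Fact p.Prime], p ≠ 2 → ∀ (k : Type) [Field k] [CharP k p] (f : MvPolynomial (Fin 3) k),
      f = MvPolynomial.X 2 ^ 2 + MvPolynomial.X 0 ^ 3 * MvPolynomial.X 1 ^ 2 + MvPolynomial.X 1 ^ 3 +
        MvPolynomial.X 0 * MvPolynomial.X 1 ^ 4 →
      ∃ (X' : Scheme.{0}) (π : X' ⟶ Spec (.of (MvPolynomial (Fin 3) k ⧸ Ideal.span {f}))), IsProper π ∧
        Literature.AlgebraicGeometry.Resolution.IsBirational π ∧
        ∀ y : X', IsDomain (X'.presheaf.stalk y) ∧ ∀ d : ℕ, ringKrullDim (X'.presheaf.stalk y) = d →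
          ∀ s : Fin d → X'.presheaf.stalk y, (Ideal.span (Set.range s)).radical.IsMaximal →
            RingTheory.Sequence.IsWeaklyRegular (X'.presheaf.stalk y) (List.ofFn s) ∧
            ∀ z : X'.presheaf.stalk y, (∃ e : ℕ, z ^ p ^ e ∈
                Ideal.span ((fun w : X'.presheaf.stalk y => w ^ p ^ e) ''
                  (Ideal.span (Set.range s) : Set (X'.presheaf.stalk y)))) →
              z ∈ Ideal.span (Set.range s) := by
  intro p _ hp2 k _ _ f hf
  exact hG5f p k 3 ![2, 6, 9] 18 18 ![9, 3, 2] (by norm_num) (by decide)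
    (G1CornerVeroneseSplitting.g1CornerVeroneseSplitting k) f (X 2 ^ 2 + X 0 ^ 3 * X 1 ^ 2 + X 1 ^ 3)
    (G1TailData.weightedHomogeneousComponent_eighteen k f hf).symm (G1TailData.weightedHomogeneousComponent_lt_eighteen k f hf)
    (G1TailData.g_ne_zero k) (G1TailData.span_g1Tail_isPrime k f hf) (G1TailData.g1Tail_X_ne_zero k f hf)
    (g1Tail_offOrigin_clause p hp2 k f hf) (G1CornerGradedData.g1Corner_offOrigin_clause p hp2 k _ rfl)

/-- **`z² + x³y² + y³ + xy⁴` AT EVERY ODD PRIME IS F-INJECTIVELY MACAULAYFIED BY ONE `(2,6,9)`-WEIGHTED BLOW-UP — UNCONDITIONAL**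
(G6f; the filtered engine G5♮ `FilteredConeFiModel.filteredConeFiModel` has LANDED): a non-quasi-homogeneous surface point whose weighted
tangent cone is stub-1's corner specimen `z² + x³y² + y³`. [folklore] -/
theorem g1TailFilteredFiModel :
    ∀ (p : ℕ) [Fact p.Prime], p ≠ 2 → ∀ (k : Type) [Field k] [CharP k p] (f : MvPolynomial (Fin 3) k),
      f = MvPolynomial.X 2 ^ 2 + MvPolynomial.X 0 ^ 3 * MvPolynomial.X 1 ^ 2 + MvPolynomial.X 1 ^ 3 +
        MvPolynomial.X 0 * MvPolynomial.X 1 ^ 4 →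
      ∃ (X' : Scheme.{0}) (π : X' ⟶ Spec (.of (MvPolynomial (Fin 3) k ⧸ Ideal.span {f}))), IsProper π ∧
        Literature.AlgebraicGeometry.Resolution.IsBirational π ∧
        ∀ y : X', IsDomain (X'.presheaf.stalk y) ∧ ∀ d : ℕ, ringKrullDim (X'.presheaf.stalk y) = d →
          ∀ s : Fin d → X'.presheaf.stalk y, (Ideal.span (Set.range s)).radical.IsMaximal →
            RingTheory.Sequence.IsWeaklyRegular (X'.presheaf.stalk y) (List.ofFn s) ∧
            ∀ z : X'.presheaf.stalk y, (∃ e : ℕ, z ^ p ^ e ∈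
                Ideal.span ((fun w : X'.presheaf.stalk y => w ^ p ^ e) ''
                  (Ideal.span (Set.range s) : Set (X'.presheaf.stalk y)))) →
              z ∈ Ideal.span (Set.range s) :=
  g1TailFilteredFiModel_of_filteredEngine FilteredConeFiModel.filteredConeFiModel

end Summit.ResolutionOfSingularities.ResolutionOfSingularities.Theorems.FInjectiveMacaulayfication.G1TailFilteredFiModel

end
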